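import Summits.Langlands.Langlands.Theses.AbelianSurfaceSerre

/-!
# `AbelianSurfaceSerre.SurfaceSectorComplement` (stmt-Langlands-17767), line `Sketch` — the junction
stubs versus the summit (negative-side lemmas)

Disprover's kernel-checked record (cdisprove cycle 1, 2026-08-17) of why no stub of the picked line
`Cruxes/SurfaceSectorComplement/Lines/Sketch.lean` (lead prover-line-stmt-Langlands-17767-0) can be
broken short of refuting the formal summit.  The three junction stubs are written INLINE, verbatim
(no definition is introduced):

* S2a `stub_reciprocityTRCM_of_sector` : `X → Langlands_∃` over totally real and CM fields;
* S2b `stub_ascentConjugationSolvable` : `Langlands_∃` over TR ∪ CM ⇒ over conjugation-solvable fields;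
* S2c `stub_ascentResidual` : `Langlands_∃` over conjugation-solvable fields ⇒ over all number fields.

Each is IMPLIED BY `Langlands` (discard the antecedent; take the reciprocity datum from the summit's
non-vacuity conjunct `Nonempty (ReciprocityData F)`), so a refutation of any of them is a refutation of
the summit (`…_not_langlands_of_not_stub…`); and S2a is implied by the crux itself through the target,
so `¬ S2a → ¬ SurfaceSectorComplement` (hence `¬ S2a → X ∧ ¬ Langlands` by the landed
`abelianSurfaceSerre_not_surfaceSectorComplement_iff`).  The fourth stub S1 `stub_recRigidity`
(rigidity of pinned reciprocity data) is delegated to line 18745 and is not restated; the disprover's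
mutation finding on it (it is consumed only at L-algebraic `π`) is in the work file
`Cruxes/SurfaceSectorComplement/Disproof.lean` §6.  Nothing here asserts a stub, the crux, the target
or the summit.
-/

set_option linter.dupNamespace false -- project-wide option; `Summit.Langlands.Langlands` is the mandated namespace

namespace Summit.Langlands.Langlands.Theorems

open Summit.Langlands.Langlands.Theses.AbelianSurfaceSerre
open Literature.NumberTheory.Automorphic Summit.Langlands

/-- **A refutation of stub S2a (`stub_reciprocityTRCM_of_sector`, stated inline) refutes the summit**:
`Langlands` gives S2a's conclusion for every base field, ignoring both the target and the TR/CM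
restriction. [folklore] -/
theorem abelianSurfaceSerre_not_langlands_of_not_stubReciprocityTRCM
    (h : ¬ (EndTrivialSurfacesModular →
      ∀ (F : Type) [Field F] [NumberField F],
        (NumberField.IsTotallyReal F ∨ NumberField.IsCMField F) →
          ∃ R : ReciprocityData F, ∀ n : ℕ, 0 < n →
            ∀ hcpt : isCompact_glFiniteIntegralLevel n F, GlobalLanglandsCorrespondenceGLn n F R hcpt)) :
    ¬ _root_.Langlands := by
  intro hL
  apply h
  intro _ F _ _ _
  obtain ⟨⟨𝓡⟩, hall⟩ := hL F
  exact ⟨𝓡, hall 𝓡⟩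

/-- **… and refutes the crux** (the crux gives `Langlands` from the target, whence S2a):
`¬ S2a → ¬ SurfaceSectorComplement`. [folklore] -/
theorem abelianSurfaceSerre_not_surfaceSectorComplement_of_not_stubReciprocityTRCM
    (h : ¬ (EndTrivialSurfacesModular →
      ∀ (F : Type) [Field F] [NumberField F],
        (NumberField.IsTotallyReal F ∨ NumberField.IsCMField F) →
          ∃ R : ReciprocityData F, ∀ n : ℕ, 0 < n →
            ∀ hcpt : isCompact_glFiniteIntegralLevel n F, GlobalLanglandsCorrespondenceGLn n F R hcpt)) :
    ¬ SurfaceSectorComplement := by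
  intro hC
  apply h
  intro hX F _ _ _
  obtain ⟨⟨𝓡⟩, hall⟩ := hC hX F
  exact ⟨𝓡, hall 𝓡⟩

/-- **A refutation of stub S2b (`stub_ascentConjugationSolvable`, stated inline) refutes the summit**
(its conclusion alone follows from `Langlands`). [folklore] -/
theorem abelianSurfaceSerre_not_langlands_of_not_stubAscentConjugationSolvable
    (h : ¬ ((∀ (F : Type) [Field F] [NumberField F],
        (NumberField.IsTotallyReal F ∨ NumberField.IsCMField F) →
          ∃ R : ReciprocityData F, ∀ n : ℕ, 0 < n →
            ∀ hcpt : isCompact_glFiniteIntegralLevel n F,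
              GlobalLanglandsCorrespondenceGLn n F R hcpt) →
      ∀ (F : Type) [Field F] [NumberField F],
        (∃ (F₀ E : Type) (_ : Field F₀) (_ : NumberField F₀) (_ : Field E) (_ : NumberField E)
            (_ : Algebra F₀ F) (_ : Algebra F E) (_ : Algebra F₀ E) (_ : IsScalarTower F₀ F E)
            (_ : IsGalois F₀ E), NumberField.IsTotallyReal F₀ ∧ IsSolvable (E ≃ₐ[F₀] E)) →
          ∃ R : ReciprocityData F, ∀ n : ℕ, 0 < n →
            ∀ hcpt : isCompact_glFiniteIntegralLevel n F,
              GlobalLanglandsCorrespondenceGLn n F R hcpt)) :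
    ¬ _root_.Langlands := by
  intro hL
  apply h
  intro _ F _ _ _
  obtain ⟨⟨𝓡⟩, hall⟩ := hL F
  exact ⟨𝓡, hall 𝓡⟩

/-- **A refutation of stub S2c (`stub_ascentResidual`, stated inline) refutes the summit** (its
conclusion `Langlands_∃` follows from `Langlands`). [folklore] -/
theorem abelianSurfaceSerre_not_langlands_of_not_stubAscentResidual
    (h : ¬ ((∀ (F : Type) [Field F] [NumberField F],
        (∃ (F₀ E : Type) (_ : Field F₀) (_ : NumberField F₀) (_ : Field E) (_ : NumberField E)
            (_ : Algebra F₀ F) (_ : Algebra F E) (_ : Algebra F₀ E) (_ : IsScalarTower F₀ F E)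
            (_ : IsGalois F₀ E), NumberField.IsTotallyReal F₀ ∧ IsSolvable (E ≃ₐ[F₀] E)) →
          ∃ R : ReciprocityData F, ∀ n : ℕ, 0 < n →
            ∀ hcpt : isCompact_glFiniteIntegralLevel n F,
              GlobalLanglandsCorrespondenceGLn n F R hcpt) →
      ∀ (F : Type) [Field F] [NumberField F], ∃ R : ReciprocityData F, ∀ n : ℕ, 0 < n →
        ∀ hcpt : isCompact_glFiniteIntegralLevel n F, GlobalLanglandsCorrespondenceGLn n F R hcpt)) :
    ¬ _root_.Langlands := by
  intro hL
  apply h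
  intro _ F _ _
  obtain ⟨⟨𝓡⟩, hall⟩ := hL F
  exact ⟨𝓡, hall 𝓡⟩

end Summit.Langlands.Langlands.Theorems
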